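import Summits.Schanuel.Schanuel.Theorems.ZilberEacFibrationProj
import Summits.Schanuel.Schanuel.Theorems.ZilberEacFibreCylinder
import HarnessLib

/-!
# The fibration principle, III: the fibred periodic piece of `EC(3,2)` from Mantova–Masser's question

Zilber's Exponential-Algebraic Closedness, case ladder (host summit Schanuel, cell `pub-schanuel`,
seat 2, gen 5).  We certify that for `W` in the normalised fibred periodic piece
`ECCellPeriodicStdFib 2` (seat 1, `EACPeriodicReduction`: `W ⊆ ℂ³ × ℂ³` irreducible of dimension
`3`, additively free, `addProjDim = 2`, base period `e₃`, `dim cl[Δ_2](W ∩ G³) = 2`) the honest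
projected surface `S = cl pr(W ∩ G³) ⊆ ℂ² × ℂ²` satisfies ALL hypotheses of Mantova–Masser's case
(dim-π-S-1-free) as typed by seat 1 (`MMCaseDimPiOneFree`: irreducible closed, meets `G²`, `dim S = 2`,
`addProjDim S = 1`, `cl π(S)` not a line of rational slope), and conclude:

**Theorem** (`ecCellPeriodicStdFib_two_of_mmDensity`).  If the answer to Mantova–Masser's
question (PLMS 2024, §1 "Further remarks": are the unprojected exponential points Zariski dense in
`S`?) is YES for every surface of case (dim-π-S-1-free), then the fibred periodic piece
`ECCellPeriodicStdFib 2` of `EC(3,2)` holds.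

General-`d` certificate lemmas: `isIrreducibleClosed_projClosure`, `projClosure_inter_torusLocus_nonempty`,
`zariskiDim_projClosure_eq` (`dim S = dim cl[Δ_d](W ∩ Gⁿ)`, both coordinate rings being `ℂ[s̄]`),
`addProjDim_eq_addProjDim_projClosure_add_one` (period `e_last` ⇒ the base is a cylinder,
`ZilberEacFibreCylinder`), and for `d = 2` `not_isRationalSlopeLine_projClosure` (additive freeness).

HONEST FRAMING: a reduction of an OPEN piece to a question OPEN in print (decided instances: seat 1's
`EACDensityQuestion`/`EACDensityFamilies`); `EC(3,2)` OPEN; nothing here bears on Schanuel's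
conjecture (EAC does not imply SC); no statement of Mantova–Masser is used as a hypothesis.
-/

noncomputable section

open MvPolynomial
open Literature.NumberTheory.Transcendental Literature.ModelTheory.Zilber

set_option linter.dupNamespace false

namespace Summit.Schanuel.Schanuel.Theorems

variable {d : ℕ}

/-! ## The projected variety `S = cl pr(W ∩ Gⁿ)` -/

section Proj

/-- Polynomials vanishing on a projection `pr(X)` are the pull-backs of those vanishing on `X`:
`I(pr X) = comap (rename ι) I(X)`. [folklore] -/
theorem vanishingIdeal_image_proj_eq_comap {K : Type*} [Field K] (X : Set (Fin (d + 1) ⊕ Fin (d + 1) → K)) :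
    vanishingIdeal K ((fun (w : Fin (d + 1) ⊕ Fin (d + 1) → K) (t : Fin d ⊕ Fin d) =>
        w (Sum.map Fin.castSucc Fin.castSucc t)) '' X) =
      (vanishingIdeal K X).comap (rename (R := K) (Sum.map (Fin.castSucc (n := d)) (Fin.castSucc (n := d))) :
        MvPolynomial (Fin d ⊕ Fin d) K →+* MvPolynomial (Fin (d + 1) ⊕ Fin (d + 1)) K) := by
  ext f
  rw [Ideal.mem_comap, mem_vanishingIdeal_iff, mem_vanishingIdeal_iff]
  constructor
  · intro h w hw
    have := h _ ⟨w, hw, rfl⟩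
    change aeval w (rename _ f) = 0
    rwa [aeval_rename]
  · rintro h _ ⟨w, hw, rfl⟩
    have := h w hw
    change aeval w (rename _ f) = 0 at this
    rwa [aeval_rename] at this

variable {W : Set (Fin (d + 1) ⊕ Fin (d + 1) → ℂ)}

/-- `S = cl pr(W ∩ Gⁿ)` is irreducible closed for irreducible `W` meeting the torus. [folklore] -/
theorem isIrreducibleClosed_projClosure (hW : IsIrreducibleClosed ℂ W)
    (hne : (W ∩ torusLocus ℂ (d + 1)).Nonempty) :
    IsIrreducibleClosed ℂ (zeroLocus ℂ (vanishingIdeal ℂ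
      ((fun (w : Fin (d + 1) ⊕ Fin (d + 1) → ℂ) (t : Fin d ⊕ Fin d) =>
        w (Sum.map Fin.castSucc Fin.castSucc t)) '' (W ∩ torusLocus ℂ (d + 1))))) := by
  refine ⟨isZariskiClosed_zeroLocus _, ?_⟩
  rw [vanishingIdeal_zeroLocus_vanishingIdeal, vanishingIdeal_image_proj_eq_comap,
    vanishingIdeal_inter_torusLocus hW hne]
  haveI := hW.2
  exact Ideal.IsPrime.comap _

/-- `S = cl pr(W ∩ Gⁿ)` meets the torus `G^d`. [folklore] -/
theorem projClosure_inter_torusLocus_nonempty (hne : (W ∩ torusLocus ℂ (d + 1)).Nonempty) :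
    (zeroLocus ℂ (vanishingIdeal ℂ
      ((fun (w : Fin (d + 1) ⊕ Fin (d + 1) → ℂ) (t : Fin d ⊕ Fin d) =>
        w (Sum.map Fin.castSucc Fin.castSucc t)) '' (W ∩ torusLocus ℂ (d + 1)))) ∩
      torusLocus ℂ d).Nonempty := by
  obtain ⟨w, hw⟩ := hne
  refine ⟨fun t => w (Sum.map Fin.castSucc Fin.castSucc t), ?_, fun i => ?_⟩
  · exact le_zeroLocus_iff_le_vanishingIdeal.2 le_rfl ⟨w, hw, rfl⟩
  · simpa only [Sum.map_inr] using hw.2 (Fin.castSucc i)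

/-- **`dim cl pr(W ∩ Gⁿ) = dim cl[Δ_d](W ∩ Gⁿ)`**: both coordinate rings are the ring `ℂ[s̄]`
generated by the small coordinates of the generic point. [folklore] -/
theorem zariskiDim_projClosure_eq (hW : IsIrreducibleClosed ℂ W)
    (hne : (W ∩ torusLocus ℂ (d + 1)).Nonempty) :
    zariskiDim ℂ (zeroLocus ℂ (vanishingIdeal ℂ
      ((fun (w : Fin (d + 1) ⊕ Fin (d + 1) → ℂ) (t : Fin d ⊕ Fin d) =>
        w (Sum.map Fin.castSucc Fin.castSucc t)) '' (W ∩ torusLocus ℂ (d + 1))))) =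
      zariskiDim ℂ (matrixAct (dropLastMat d) '' (W ∩ torusLocus ℂ (d + 1))) := by
  classical
  have hWP : W = zeroLocus ℂ (vanishingIdeal ℂ W) := eq_zeroLocus_vanishingIdeal_of_isZariskiClosed hW.1
  set P := vanishingIdeal ℂ W with hP
  haveI : P.IsPrime := hW.2
  have hneP : (zeroLocus ℂ P ∩ torusLocus ℂ (d + 1)).Nonempty := by rwa [← hWP]
  set ξ := genericPt P with hξ
  set sbar : Fin d ⊕ Fin d → zeroLocusFunctionField P :=
    fun t => ξ (Sum.map Fin.castSucc Fin.castSucc t) with hsbar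
  -- the two vanishing ideals are kernels of evaluation at `sbar`, resp. `[Δ_d] ξ`
  have hIS : vanishingIdeal ℂ (zeroLocus ℂ (vanishingIdeal ℂ
      ((fun (w : Fin (d + 1) ⊕ Fin (d + 1) → ℂ) (t : Fin d ⊕ Fin d) =>
        w (Sum.map Fin.castSucc Fin.castSucc t)) '' (W ∩ torusLocus ℂ (d + 1))))) =
      RingHom.ker (MvPolynomial.aeval (R := ℂ) sbar :
        MvPolynomial (Fin d ⊕ Fin d) ℂ →+* zeroLocusFunctionField P) := by
    rw [vanishingIdeal_zeroLocus_vanishingIdeal, vanishingIdeal_image_proj_eq_comap,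
      vanishingIdeal_inter_torusLocus hW hne]
    ext f
    rw [Ideal.mem_comap, RingHom.mem_ker, RingHom.coe_coe]
    change rename _ f ∈ P ↔ _
    rw [← isGenericPt_genericPt P (rename _ f), aeval_rename]
    exact Iff.rfl
  have hIM : vanishingIdeal ℂ (matrixAct (dropLastMat d) '' (W ∩ torusLocus ℂ (d + 1))) =
      RingHom.ker (MvPolynomial.aeval (R := ℂ) (matrixAct (dropLastMat d) ξ) :
        MvPolynomial (Fin (d + 1) ⊕ Fin (d + 1)) ℂ →+* zeroLocusFunctionField P) := by
    conv_lhs => rw [hWP]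
    rw [vanishingIdeal_image_matrixAct_eq_ker P (isGenericPt_genericPt P) hneP (dropLastMat d)]
    ext f
    rw [RingHom.mem_ker, RingHom.mem_ker, RingHom.coe_coe]
  -- the two ranges coincide
  have hR : (MvPolynomial.aeval (R := ℂ) (matrixAct (dropLastMat d) ξ) :
        MvPolynomial (Fin (d + 1) ⊕ Fin (d + 1)) ℂ →+* zeroLocusFunctionField P).range =
      (MvPolynomial.aeval (R := ℂ) sbar :
        MvPolynomial (Fin d ⊕ Fin d) ℂ →+* zeroLocusFunctionField P).range := by
    ext y
    simp only [RingHom.mem_range, RingHom.coe_coe]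
    constructor
    · rintro ⟨g, rfl⟩
      refine ⟨aeval (R := ℂ) (Sum.elim (Fin.snoc (fun i => X (Sum.inl i)) 0)
        (Fin.snoc (fun i => X (Sum.inr i)) 1) :
          Fin (d + 1) ⊕ Fin (d + 1) → MvPolynomial (Fin d ⊕ Fin d) ℂ) g, ?_⟩
      rw [aeval_sliceSubst, matrixAct_dropLastMat_eq_glue]
      rfl
    · rintro ⟨f, rfl⟩
      exact ⟨rename (Sum.map Fin.castSucc Fin.castSucc) f, aeval_matrixAct_rename_small ξ f⟩
  unfold zariskiDim
  rw [ringKrullDim_eq_of_ringEquiv ((Ideal.quotEquivOfEq hIS).trans (RingHom.quotientKerEquivRange _)),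
    ringKrullDim_eq_of_ringEquiv ((Ideal.quotEquivOfEq hIM).trans (RingHom.quotientKerEquivRange _)),
    ringKrullDim_eq_of_ringEquiv (RingEquiv.subringCongr hR)]

/-- **The base of `S` is the base of `W` with the period collapsed**: `I(π(S ∩ G^d)) = I(π(W ∩ Gⁿ)) ∩ ℂ[x']`.
[folklore] -/
theorem vanishingIdeal_projAdd_projClosure :
    vanishingIdeal ℂ (projAdd '' (zeroLocus ℂ (vanishingIdeal ℂ
      ((fun (w : Fin (d + 1) ⊕ Fin (d + 1) → ℂ) (t : Fin d ⊕ Fin d) =>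
        w (Sum.map Fin.castSucc Fin.castSucc t)) '' (W ∩ torusLocus ℂ (d + 1)))) ∩ torusLocus ℂ d)) =
      (vanishingIdeal ℂ (projAdd '' (W ∩ torusLocus ℂ (d + 1)))).comap
        (rename (R := ℂ) (Fin.castSucc (n := d)) : MvPolynomial (Fin d) ℂ →+* MvPolynomial (Fin (d + 1)) ℂ) := by
  set prW := (fun (w : Fin (d + 1) ⊕ Fin (d + 1) → ℂ) (t : Fin d ⊕ Fin d) =>
    w (Sum.map Fin.castSucc Fin.castSucc t)) '' (W ∩ torusLocus ℂ (d + 1)) with hprW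
  ext c
  rw [Ideal.mem_comap, mem_vanishingIdeal_iff, mem_vanishingIdeal_iff]
  constructor
  · intro h
    rintro _ ⟨w, hw, rfl⟩
    have hmem : (fun t => w (Sum.map Fin.castSucc Fin.castSucc t)) ∈
        zeroLocus ℂ (vanishingIdeal ℂ prW) ∩ torusLocus ℂ d :=
      ⟨le_zeroLocus_iff_le_vanishingIdeal.2 le_rfl ⟨w, hw, rfl⟩,
        fun i => by simpa only [Sum.map_inr] using hw.2 (Fin.castSucc i)⟩
    have := h _ ⟨_, hmem, rfl⟩
    change aeval (projAdd w) (rename Fin.castSucc c) = 0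
    have e : (projAdd w ∘ Fin.castSucc) =
        projAdd (fun t : Fin d ⊕ Fin d => w (Sum.map Fin.castSucc Fin.castSucc t)) := by
      funext i; rfl
    rw [aeval_rename, e]
    exact this
  · intro h
    -- `rename inl c` vanishes on `prW`, hence on its closure
    have hc : rename (R := ℂ) Sum.inl c ∈ vanishingIdeal ℂ prW := by
      rw [mem_vanishingIdeal_iff]
      rintro _ ⟨w, hw, rfl⟩
      have := h _ ⟨w, hw, rfl⟩
      change aeval (projAdd w) (rename Fin.castSucc c) = 0 at this
      have e : ((fun (w : Fin (d + 1) ⊕ Fin (d + 1) → ℂ) (t : Fin d ⊕ Fin d) =>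
          w (Sum.map Fin.castSucc Fin.castSucc t)) w ∘ Sum.inl) = (projAdd w ∘ Fin.castSucc) := by
        funext i; rfl
      rw [aeval_rename] at this ⊢
      rw [e]
      exact this
    rintro _ ⟨s, ⟨hs, -⟩, rfl⟩
    have := (mem_zeroLocus_iff.1 hs) _ hc
    rw [aeval_rename] at this
    exact this

/-- **`addProjDim W = addProjDim S + 1`** when the base of `W` has period `e_last` (it is then a
cylinder over `x_last`, and `π(S)` is its cross-section). [folklore] -/
theorem addProjDim_eq_addProjDim_projClosure_add_one
    (hper : IsPeriodVec ℂ (projAdd '' (W ∩ torusLocus ℂ (d + 1))) (Pi.single (Fin.last d) 1)) :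
    addProjDim ℂ (d + 1) W =
      addProjDim ℂ d (zeroLocus ℂ (vanishingIdeal ℂ
        ((fun (w : Fin (d + 1) ⊕ Fin (d + 1) → ℂ) (t : Fin d ⊕ Fin d) =>
          w (Sum.map Fin.castSucc Fin.castSucc t)) '' (W ∩ torusLocus ℂ (d + 1))))) + 1 := by
  haveI : Infinite ℂ := Infinite.of_injective _ Nat.cast_injective
  unfold addProjDim zariskiDim
  rw [ringKrullDim_quotient_eq_of_isPeriodVec hper, vanishingIdeal_projAdd_projClosure]

end Proj

/-! ## `d = 2`: the surface `S` lies in Mantova–Masser's case (dim-π-S-1-free) -/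

section Two

/-- `x + 1 = k + 1` in `WithBot ℕ∞` forces `x = k`. [folklore] -/
theorem withBot_enat_eq_of_add_one_eq {x : WithBot ℕ∞} {k : ℕ}
    (h : x + 1 = ((k + 1 : ℕ) : WithBot ℕ∞)) : x = (k : ℕ) := by
  induction x using WithBot.recBotCoe with
  | bot =>
    exfalso
    rw [WithBot.bot_add, ← WithBot.coe_natCast] at h
    exact WithBot.bot_ne_coe h
  | coe y =>
    induction y using ENat.recTopCoe with
    | top =>
      exfalso
      rw [← WithBot.coe_one, ← WithBot.coe_add, top_add, ← WithBot.coe_natCast] at h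
      exact ENat.top_ne_coe _ (WithBot.coe_injective h)
    | coe m =>
      have h1 : ((m : ℕ∞) : WithBot ℕ∞) + 1 = (((m + 1 : ℕ) : ℕ∞) : WithBot ℕ∞) := by norm_cast
      rw [h1, ← WithBot.coe_natCast] at h
      have h2 : ((m + 1 : ℕ) : ℕ∞) = ((k + 1 : ℕ) : ℕ∞) := WithBot.coe_injective h
      have h3 : m + 1 = k + 1 := by exact_mod_cast h2
      have hm : m = k := by omega
      rw [hm, WithBot.coe_natCast]

variable {W : Set (Fin 3 ⊕ Fin 3 → ℂ)}

/-- Additive freeness of `W` forbids `cl π(S)` to be a line of rational slope. [folklore] -/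
theorem not_isRationalSlopeLine_projClosure (hadd : IsAddFree ℂ 3 (W ∩ torusLocus ℂ 3)) :
    ¬ IsRationalSlopeLine (zeroLocus ℂ (vanishingIdeal ℂ (projAdd ''
      (zeroLocus ℂ (vanishingIdeal ℂ
        ((fun (w : Fin 3 ⊕ Fin 3 → ℂ) (t : Fin 2 ⊕ Fin 2) =>
          w (Sum.map Fin.castSucc Fin.castSucc t)) '' (W ∩ torusLocus ℂ 3))) ∩ torusLocus ℂ 2)))) := by
  rintro ⟨m, hm, c, hline⟩
  apply hadd (Fin.snoc m 0) ?_
  · refine ⟨c, fun w hw => ?_⟩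
    -- `pr w` is a torus point of `S`, so `π(pr w)` lies on the line
    set prW := (fun (w : Fin 3 ⊕ Fin 3 → ℂ) (t : Fin 2 ⊕ Fin 2) =>
      w (Sum.map Fin.castSucc Fin.castSucc t)) '' (W ∩ torusLocus ℂ 3) with hprW
    have hmem : (fun t => w (Sum.map Fin.castSucc Fin.castSucc t)) ∈
        zeroLocus ℂ (vanishingIdeal ℂ prW) ∩ torusLocus ℂ 2 :=
      ⟨le_zeroLocus_iff_le_vanishingIdeal.2 le_rfl ⟨w, hw, rfl⟩,
        fun i => by simpa only [Sum.map_inr] using hw.2 (Fin.castSucc i)⟩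
    have hpt : projAdd (fun t : Fin 2 ⊕ Fin 2 => w (Sum.map Fin.castSucc Fin.castSucc t)) ∈
        zeroLocus ℂ (vanishingIdeal ℂ (projAdd '' (zeroLocus ℂ (vanishingIdeal ℂ prW) ∩ torusLocus ℂ 2))) :=
      le_zeroLocus_iff_le_vanishingIdeal.2 le_rfl ⟨_, hmem, rfl⟩
    rw [hline] at hpt
    simp only [Set.mem_setOf_eq, projAdd_apply, Sum.map_inl] at hpt
    rw [Fin.sum_univ_castSucc, Fin.sum_univ_two, Fin.snoc_castSucc, Fin.snoc_castSucc, Fin.snoc_last,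
      Int.cast_zero, zero_mul, add_zero]
    exact hpt
  · intro h0
    apply hm
    funext i
    have := congrFun h0 (Fin.castSucc i)
    rwa [Fin.snoc_castSucc] at this

/-- **`S = cl pr(W ∩ G³)` is in Mantova–Masser's case (dim-π-S-1-free)** for every `W` in the
normalised fibred periodic piece of `EC(3,2)` (binders of `ECCellPeriodicStdFib 2` actually used:
irreducible, meets the torus, additively free, `addProjDim = 2`, period `e₃`, `dim cl[Δ_2] = 2`).
[cite: MantovaMasser2023, §1 Further remarks] -/
theorem mmCaseDimPiOneFree_projClosure (hW : IsIrreducibleClosed ℂ W)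
    (hne : (W ∩ torusLocus ℂ 3).Nonempty) (hadd : IsAddFree ℂ 3 (W ∩ torusLocus ℂ 3))
    (hbase : addProjDim ℂ 3 W = (2 : ℕ))
    (hper : IsPeriodVec ℂ (projAdd '' (W ∩ torusLocus ℂ 3)) (Pi.single (Fin.last 2) 1))
    (hfib : zariskiDim ℂ (matrixAct (dropLastMat 2) '' (W ∩ torusLocus ℂ 3)) = (2 : ℕ)) :
    MMCaseDimPiOneFree (zeroLocus ℂ (vanishingIdeal ℂ
      ((fun (w : Fin 3 ⊕ Fin 3 → ℂ) (t : Fin 2 ⊕ Fin 2) =>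
        w (Sum.map Fin.castSucc Fin.castSucc t)) '' (W ∩ torusLocus ℂ 3)))) := by
  refine ⟨isIrreducibleClosed_projClosure hW hne, projClosure_inter_torusLocus_nonempty hne, ?_, ?_,
    not_isRationalSlopeLine_projClosure hadd⟩
  · rw [zariskiDim_projClosure_eq hW hne, hfib]
  · have h := addProjDim_eq_addProjDim_projClosure_add_one hper
    rw [hbase] at h
    exact withBot_enat_eq_of_add_one_eq h.symm

/-- **The fibred periodic piece of `EC(3,2)` follows from a YES to Mantova–Masser's question.**
If every surface `S ⊆ ℂ² × ℂ²` of case (dim-π-S-1-free) (`MMCaseDimPiOneFree S`) has Zariski-dense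
exponential points (`UnprojectedDense S`), then `ECCellPeriodicStdFib 2`. [cite: MantovaMasser2023, §1 Further remarks] -/
theorem ecCellPeriodicStdFib_two_of_mmDensity
    (h : ∀ S : Set (Fin 2 ⊕ Fin 2 → ℂ), MMCaseDimPiOneFree S → UnprojectedDense S) :
    ECCellPeriodicStdFib 2 := by
  intro W hW hne _ hadd _ hdim hbase hper hfib
  exact inter_expGraph_nonempty_of_unprojectedDense_proj hW hne hdim hfib
    (h _ (mmCaseDimPiOneFree_projClosure hW hne hadd hbase hper hfib))

end Two

end Summit.Schanuel.Schanuel.Theorems
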